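import Mathlib
import HarnessLib

/-!
# Nonlinear transformations of a converging improper integral (Davis–Rabinowitz 1984, Sect. 3.2.2)

Davis–Rabinowitz, *Methods of Numerical Integration* (2nd ed., 1984), Sect. 3.2.2 "Nonlinear Transformations"
(after Gray, Atchison et al.).  Let `F(t) = ∫_a^t f` converge to `S` as `t → ∞`.

* **Definition.**  `F₁` *converges more rapidly* to `S` than `F` if `(S - F₁ t)/(S - F t) → 0`
  (`ConvergesMoreRapidly`).
* `R(t; k) = f(t + k)/f(t)` (`tailRatio`) and the **G-transform** (3.2.2.1)
  `G[F; t, k] = (F(t + k) - R(t, k) F(t)) / (1 - R(t, k))` (`gTransform`); its limiting case with a constant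
  `R` (`gTransformLim`); `ρ(t; k) = k f(kt)/f(t)` (`tailScaleRatio`) and the **B-transform** (3.2.2.2)
  (`bTransform`); the **Q-transform** `Q[F; t] = (q G[F; t, 1] - F(t))/(q - 1)` (`qTransform`).
* **Theorem (convergence).**  If `F → S` and `R(t, k) → r ≠ 1` then `G[F; t, k] → S`
  (`tendsto_gTransform`); likewise for the limiting case and for `B` (`tendsto_bTransform`, `k > 0`).
* **Theorem (acceleration).**  If moreover `r ≠ 0`, `f` is continuous and eventually nonzero, then
  `G[F; t, k]` converges to `S` more rapidly than `F(t + k)` (`gTransform_convergesMoreRapidly`), and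
  `B[F; t, k]` more rapidly than `F(kt)` (`bTransform_convergesMoreRapidly`).  The mechanism
  (`tendsto_transform_div_tail`) is l'Hôpital's rule at `∞` applied to the two tails
  `S - F(t)` and `S - F(t + k)` (resp. `S - F(kt)`), whose derivatives are `-f(t)` and `-f(t + k)`
  (resp. `-k f(kt)`); Rolle's theorem shows the tails are eventually nonzero.
* **The analytic example of the text:**  `F(t) = ∫_0^t dx/(1 + x)² = 1 - 1/(t + 1)`,
  `R(t, 1) = ((t + 1)/(t + 2))²`, `G[F; t, 1] = 1 - 1/(2t + 3)`, `q = lim t (1 - R(t, 1)) = 2`,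
  `Q[F; t] = 1 + 1/((t + 1)(2t + 3))`; and the shape of `G[F; t, π]` for `F(t) = ∫_0^t sin x / x dx`
  (`R(t; π) = -t/(t + π)`).

No `sorry`; standard axioms only.
-/

noncomputable section

open Filter Topology MeasureTheory intervalIntegral Set

namespace Literature.Analysis.Quadrature

/-! ### Definitions -/

/-- `F₁` converges to `S` *more rapidly* than `F`: `(S - F₁(t))/(S - F(t)) → 0` as `t → ∞`.
[cite: DavisRabinowitz1984, Sect. 3.2.2 (Definition)] -/
def ConvergesMoreRapidly (F₁ F : ℝ → ℝ) (S : ℝ) : Prop :=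
  Tendsto (fun t => (S - F₁ t) / (S - F t)) atTop (𝓝 0)

/-- `R(t; k) = f(t + k)/f(t)`.  [cite: DavisRabinowitz1984, Sect. 3.2.2 (3.2.2.1)] -/
def tailRatio (f : ℝ → ℝ) (t k : ℝ) : ℝ := f (t + k) / f t

/-- The **G-transform** (3.2.2.1): `G[F; t, k] = (F(t + k) - R(t, k) F(t)) / (1 - R(t, k))` with
`R(t, k) = f(t + k)/f(t)`, `f = F'`.  [cite: DavisRabinowitz1984, Sect. 3.2.2 (3.2.2.1)] -/
def gTransform (f F : ℝ → ℝ) (t k : ℝ) : ℝ :=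
  (F (t + k) - tailRatio f t k * F t) / (1 - tailRatio f t k)

/-- The limiting case of the G-transform: `R(t, k)` replaced by a constant `R` (the limit `R(k)`).
[cite: DavisRabinowitz1984, Sect. 3.2.2 (3.2.2.1)] -/
def gTransformLim (F : ℝ → ℝ) (R : ℝ) (t k : ℝ) : ℝ := (F (t + k) - R * F t) / (1 - R)

/-- `ρ(t; k) = k f(kt)/f(t)`.  [cite: DavisRabinowitz1984, Sect. 3.2.2 (3.2.2.2)] -/
def tailScaleRatio (f : ℝ → ℝ) (t k : ℝ) : ℝ := k * f (k * t) / f t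

/-- The **B-transform** (3.2.2.2): `B[F; t, k] = (F(kt) - ρ(t, k) F(t)) / (1 - ρ(t, k))`.
[cite: DavisRabinowitz1984, Sect. 3.2.2 (3.2.2.2)] -/
def bTransform (f F : ℝ → ℝ) (t k : ℝ) : ℝ :=
  (F (k * t) - tailScaleRatio f t k * F t) / (1 - tailScaleRatio f t k)

/-- The **Q-transform**: `Q[F; t] = (q G[F; t, 1] - F(t))/(q - 1)`, where `q = lim t (1 - R(t, 1))`
is supplied as a parameter.  [cite: DavisRabinowitz1984, Sect. 3.2.2 (Q-transform)] -/
def qTransform (f F : ℝ → ℝ) (q t : ℝ) : ℝ := (q * gTransform f F t 1 - F t) / (q - 1)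

/-! ### The error of a transform in terms of the two tails -/

/-- [folklore] For `R ≠ 1`: `S - (A - R B)/(1 - R) = ((S - A) - R (S - B))/(1 - R)`. -/
private theorem sub_transform_eq {S A B R : ℝ} (hR : R ≠ 1) :
    S - (A - R * B) / (1 - R) = ((S - A) - R * (S - B)) / (1 - R) := by
  have h1 : (1 - R) ≠ 0 := sub_ne_zero.mpr (Ne.symm hR)
  field_simp
  ring

/-- The error of the G-transform in terms of the tails `S - F(t + k)` and `S - F(t)` (`R(t, k) ≠ 1`).
[cite: DavisRabinowitz1984, Sect. 3.2.2 (3.2.2.1)] -/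
theorem sub_gTransform_eq (f F : ℝ → ℝ) (S t k : ℝ) (hR : tailRatio f t k ≠ 1) :
    S - gTransform f F t k =
      ((S - F (t + k)) - tailRatio f t k * (S - F t)) / (1 - tailRatio f t k) :=
  sub_transform_eq hR

/-- The error of the B-transform in terms of the tails `S - F(kt)` and `S - F(t)` (`ρ(t, k) ≠ 1`).
[cite: DavisRabinowitz1984, Sect. 3.2.2 (3.2.2.2)] -/
theorem sub_bTransform_eq (f F : ℝ → ℝ) (S t k : ℝ) (hρ : tailScaleRatio f t k ≠ 1) :
    S - bTransform f F t k =
      ((S - F (k * t)) - tailScaleRatio f t k * (S - F t)) / (1 - tailScaleRatio f t k) :=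
  sub_transform_eq hρ

/-! ### Convergence of the transforms -/

/-- [folklore] The common limit computation: if both tails tend to `0` and `R(t) → r ≠ 1`, then
`((e₂ t) - R t (e₁ t))/(1 - R t) → 0`. -/
private theorem tendsto_tail_comb {e₁ e₂ R : ℝ → ℝ} {r : ℝ} (hr : r ≠ 1)
    (h₁ : Tendsto e₁ atTop (𝓝 0)) (h₂ : Tendsto e₂ atTop (𝓝 0)) (hR : Tendsto R atTop (𝓝 r)) :
    Tendsto (fun t => (e₂ t - R t * e₁ t) / (1 - R t)) atTop (𝓝 0) := by
  have hden : Tendsto (fun t => 1 - R t) atTop (𝓝 (1 - r)) := tendsto_const_nhds.sub hR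
  have hnum : Tendsto (fun t => e₂ t - R t * e₁ t) atTop (𝓝 (0 - r * 0)) := h₂.sub (hR.mul h₁)
  have h := hnum.div hden (sub_ne_zero.mpr (Ne.symm hr))
  have h0 : (0 - r * 0) / (1 - r) = (0:ℝ) := by simp
  rw [h0] at h
  exact h

/-- **Convergence of the G-transform.**  If `F(t) → S` and `R(t, k) → r ≠ 1`, then `G[F; t, k] → S`.
[cite: DavisRabinowitz1984, Sect. 3.2.2 (3.2.2.1)] -/
theorem tendsto_gTransform {f F : ℝ → ℝ} {S r : ℝ} (k : ℝ) (hF : Tendsto F atTop (𝓝 S))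
    (hR : Tendsto (fun t => tailRatio f t k) atTop (𝓝 r)) (hr : r ≠ 1) :
    Tendsto (fun t => gTransform f F t k) atTop (𝓝 S) := by
  have e₁ : Tendsto (fun t => S - F t) atTop (𝓝 0) := by
    simpa using (tendsto_const_nhds (x := S)).sub hF
  have e₂ : Tendsto (fun t => S - F (t + k)) atTop (𝓝 0) := by
    have := hF.comp (tendsto_atTop_add_const_right atTop k tendsto_id)
    simpa using (tendsto_const_nhds (x := S)).sub this
  have hev : ∀ᶠ t in atTop, tailRatio f t k ≠ 1 := hR.eventually (isOpen_ne.mem_nhds hr)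
  have key := tendsto_tail_comb hr e₁ e₂ hR
  have : Tendsto (fun t => S - gTransform f F t k) atTop (𝓝 0) :=
    key.congr' (hev.mono fun t ht => (sub_gTransform_eq f F S t k ht).symm)
  have h3 := (tendsto_const_nhds (x := S)).sub this
  simpa using h3

/-- **Convergence of the limiting G-transform** (constant `R ≠ 1`).
[cite: DavisRabinowitz1984, Sect. 3.2.2 (3.2.2.1)] -/
theorem tendsto_gTransformLim {F : ℝ → ℝ} {S R : ℝ} (k : ℝ) (hF : Tendsto F atTop (𝓝 S))
    (hR : R ≠ 1) : Tendsto (fun t => gTransformLim F R t k) atTop (𝓝 S) := by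
  have h2 : Tendsto (fun t => F (t + k)) atTop (𝓝 S) :=
    hF.comp (tendsto_atTop_add_const_right atTop k tendsto_id)
  have := (h2.sub (hF.const_mul R)).div_const (1 - R)
  have h1 : (1 - R) ≠ 0 := sub_ne_zero.mpr (Ne.symm hR)
  simp only [gTransformLim]
  convert this using 2
  field_simp

/-- **Convergence of the B-transform** (`k > 0`).  If `F(t) → S` and `ρ(t, k) → ρ ≠ 1`, then
`B[F; t, k] → S`.  [cite: DavisRabinowitz1984, Sect. 3.2.2 (3.2.2.2)] -/
theorem tendsto_bTransform {f F : ℝ → ℝ} {S ρ k : ℝ} (hk : 0 < k) (hF : Tendsto F atTop (𝓝 S))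
    (hρ : Tendsto (fun t => tailScaleRatio f t k) atTop (𝓝 ρ)) (hρ1 : ρ ≠ 1) :
    Tendsto (fun t => bTransform f F t k) atTop (𝓝 S) := by
  have e₁ : Tendsto (fun t => S - F t) atTop (𝓝 0) := by
    simpa using (tendsto_const_nhds (x := S)).sub hF
  have e₂ : Tendsto (fun t => S - F (k * t)) atTop (𝓝 0) := by
    have := hF.comp (tendsto_id.const_mul_atTop hk)
    simpa using (tendsto_const_nhds (x := S)).sub this
  have hev : ∀ᶠ t in atTop, tailScaleRatio f t k ≠ 1 := hρ.eventually (isOpen_ne.mem_nhds hρ1)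
  have key := tendsto_tail_comb hρ1 e₁ e₂ hρ
  have : Tendsto (fun t => S - bTransform f F t k) atTop (𝓝 0) :=
    key.congr' (hev.mono fun t ht => (sub_bTransform_eq f F S t k ht).symm)
  have h3 := (tendsto_const_nhds (x := S)).sub this
  simpa using h3

/-! ### Acceleration: l'Hôpital at infinity on the two tails -/

/-- [folklore] Rolle: a function with nonvanishing derivative on `[T, ∞)` vanishes at most once there,
hence is eventually nonzero. -/
private theorem eventually_ne_zero_of_deriv_ne_zero {e g : ℝ → ℝ} (T : ℝ)
    (he : ∀ t, T ≤ t → HasDerivAt e (g t) t) (hg : ∀ t, T ≤ t → g t ≠ 0) :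
    ∀ᶠ t in atTop, e t ≠ 0 := by
  have hcont : ∀ t, T ≤ t → ContinuousAt e t := fun t ht => (he t ht).continuousAt
  -- two zeros `s < t` in `[T, ∞)` would give a zero of the derivative in between
  have hone : ∀ s t, T ≤ s → s < t → e s = 0 → e t ≠ 0 := by
    intro s t hs hst hes het
    have hco : ContinuousOn e (Icc s t) := fun x hx =>
      (hcont x (hs.trans hx.1)).continuousWithinAt
    obtain ⟨c, hc, hc0⟩ := exists_hasDerivAt_eq_zero hst hco (hes.trans het.symm)
      (fun x hx => he x (hs.trans hx.1.le))
    exact hg c (hs.trans hc.1.le) hc0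
  by_cases h : ∃ s, T ≤ s ∧ e s = 0
  · obtain ⟨s, hs, hes⟩ := h
    filter_upwards [eventually_gt_atTop s] with t ht using hone s t hs ht hes
  · filter_upwards [eventually_ge_atTop T] with t ht using fun het => h ⟨t, ht, het⟩

/-- **The acceleration mechanism** (the heart of the Gray–Atchison argument).  Let `e₁, e₂ → 0` at `∞`
be differentiable beyond `T` with `e₁' = -f`, `e₂' = -g`, `g ≠ 0` beyond `T`, and let
`R(t) = g(t)/f(t) → r` with `r ≠ 0, 1`.  Then `((e₂ t) - R(t) e₁(t))/(1 - R(t))` is `o(e₂(t))`.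
(For the G-transform `e₁ = S - F`, `e₂(t) = S - F(t + k)`, `g(t) = f(t + k)`; for the B-transform
`e₂(t) = S - F(kt)`, `g(t) = k f(kt)`.)  [cite: DavisRabinowitz1984, Sect. 3.2.2 (3.2.2.1)-(3.2.2.2)] -/
theorem tendsto_transform_div_tail {e₁ e₂ f g R : ℝ → ℝ} {r : ℝ} (T : ℝ)
    (h₁ : ∀ t, T ≤ t → HasDerivAt e₁ (-f t) t) (h₂ : ∀ t, T ≤ t → HasDerivAt e₂ (-g t) t)
    (hg : ∀ t, T ≤ t → g t ≠ 0) (hl₁ : Tendsto e₁ atTop (𝓝 0)) (hl₂ : Tendsto e₂ atTop (𝓝 0))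
    (hRdef : ∀ t, T ≤ t → R t = g t / f t) (hR : Tendsto R atTop (𝓝 r)) (hr0 : r ≠ 0) (hr1 : r ≠ 1) :
    Tendsto (fun t => ((e₂ t - R t * e₁ t) / (1 - R t)) / e₂ t) atTop (𝓝 0) := by
  -- l'Hôpital: e₁/e₂ → 1/r
  have hquot : Tendsto (fun t => e₁ t / e₂ t) atTop (𝓝 r⁻¹) := by
    have hderiv : Tendsto (fun t => (-f t) / (-g t)) atTop (𝓝 r⁻¹) := by
      have h' : Tendsto (fun t => (R t)⁻¹) atTop (𝓝 r⁻¹) := hR.inv₀ hr0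
      refine h'.congr' ?_
      filter_upwards [eventually_ge_atTop T] with t ht
      rw [hRdef t ht, inv_div, neg_div_neg_eq]
    exact HasDerivAt.lhopital_zero_atTop ((eventually_ge_atTop T).mono fun t ht => h₁ t ht)
      ((eventually_ge_atTop T).mono fun t ht => h₂ t ht)
      ((eventually_ge_atTop T).mono fun t ht => neg_ne_zero.mpr (hg t ht)) hl₁ hl₂ hderiv
  have hne : ∀ᶠ t in atTop, e₂ t ≠ 0 :=
    eventually_ne_zero_of_deriv_ne_zero T h₂ fun t ht => neg_ne_zero.mpr (hg t ht)
  -- the ratio equals (1 - R t * (e₁ t / e₂ t)) / (1 - R t) wherever e₂ t ≠ 0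
  have hlim : Tendsto (fun t => (1 - R t * (e₁ t / e₂ t)) / (1 - R t)) atTop (𝓝 0) := by
    have hnum : Tendsto (fun t => 1 - R t * (e₁ t / e₂ t)) atTop (𝓝 (1 - r * r⁻¹)) :=
      tendsto_const_nhds.sub (hR.mul hquot)
    have hden : Tendsto (fun t => 1 - R t) atTop (𝓝 (1 - r)) := tendsto_const_nhds.sub hR
    have h := hnum.div hden (sub_ne_zero.mpr (Ne.symm hr1))
    have h0 : (1 - r * r⁻¹) / (1 - r) = (0:ℝ) := by rw [mul_inv_cancel₀ hr0]; simp
    rw [h0] at h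
    exact h
  refine hlim.congr' ?_
  filter_upwards [hne] with t ht
  field_simp

/-- **Acceleration by the G-transform.**  Let `f` be continuous, `F(t) = ∫_a^t f → S`, `f(t) ≠ 0` for
`t ≥ T`, and `R(t, k) = f(t + k)/f(t) → r` with `r ≠ 0, 1` (`k ≥ 0`).  Then `G[F; t, k]` converges
to `S` more rapidly than `F(t + k)`.  [cite: DavisRabinowitz1984, Sect. 3.2.2 (3.2.2.1)] -/
theorem gTransform_convergesMoreRapidly {f : ℝ → ℝ} (hf : Continuous f) (a : ℝ) {S r k T : ℝ}
    (hk : 0 ≤ k) (hS : Tendsto (fun t => ∫ x in a..t, f x) atTop (𝓝 S))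
    (hf0 : ∀ t, T ≤ t → f t ≠ 0)
    (hR : Tendsto (fun t => tailRatio f t k) atTop (𝓝 r)) (hr0 : r ≠ 0) (hr1 : r ≠ 1) :
    ConvergesMoreRapidly (fun t => gTransform f (fun t => ∫ x in a..t, f x) t k)
      (fun t => ∫ x in a..(t + k), f x) S := by
  set F : ℝ → ℝ := fun t => ∫ x in a..t, f x with hFdef
  have hFd : ∀ t, HasDerivAt F (f t) t := fun t =>
    intervalIntegral.integral_hasDerivAt_right (hf.intervalIntegrable _ _)
      (hf.stronglyMeasurableAtFilter _ _) hf.continuousAt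
  have h₁ : ∀ t, T ≤ t → HasDerivAt (fun t => S - F t) (-f t) t := fun t _ => by
    simpa using (hFd t).const_sub S
  have h₂ : ∀ t, T ≤ t → HasDerivAt (fun t => S - F (t + k)) (-f (t + k)) t := fun t _ => by
    have hc := (hFd (t + k)).comp t ((hasDerivAt_id t).add_const k)
    simpa [Function.comp_def] using hc.const_sub S
  have hl₁ : Tendsto (fun t => S - F t) atTop (𝓝 0) := by
    simpa using (tendsto_const_nhds (x := S)).sub hS
  have hshift : Tendsto (fun t => F (t + k)) atTop (𝓝 S) :=
    hS.comp (tendsto_atTop_add_const_right atTop k tendsto_id)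
  have hl₂ : Tendsto (fun t => S - F (t + k)) atTop (𝓝 0) := by
    simpa using (tendsto_const_nhds (x := S)).sub hshift
  have core := tendsto_transform_div_tail (e₁ := fun t => S - F t) (e₂ := fun t => S - F (t + k))
    (R := fun t => tailRatio f t k) T h₁ h₂ (fun t ht => hf0 (t + k) (by linarith)) hl₁ hl₂
    (fun t _ => rfl) hR hr0 hr1
  have hev : ∀ᶠ t in atTop, tailRatio f t k ≠ 1 := hR.eventually (isOpen_ne.mem_nhds hr1)
  refine core.congr' ?_
  filter_upwards [hev] with t ht
  rw [sub_gTransform_eq f F S t k ht]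

/-- **Acceleration by the B-transform** (`k ≥ 1`... more precisely `k > 0` with `ρ(k) ≠ 0, 1`).
Let `f` be continuous, `F(t) = ∫_a^t f → S`, `f(t) ≠ 0` for `t ≥ T ≥ 0`, and
`ρ(t, k) = k f(kt)/f(t) → ρ` with `ρ ≠ 0, 1`, `k ≥ 1`.  Then `B[F; t, k]` converges to `S` more
rapidly than `F(kt)`.  [cite: DavisRabinowitz1984, Sect. 3.2.2 (3.2.2.2)] -/
theorem bTransform_convergesMoreRapidly {f : ℝ → ℝ} (hf : Continuous f) (a : ℝ) {S ρ k T : ℝ}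
    (hk : 1 ≤ k) (hT : 0 ≤ T) (hS : Tendsto (fun t => ∫ x in a..t, f x) atTop (𝓝 S))
    (hf0 : ∀ t, T ≤ t → f t ≠ 0)
    (hρ : Tendsto (fun t => tailScaleRatio f t k) atTop (𝓝 ρ)) (hρ0 : ρ ≠ 0) (hρ1 : ρ ≠ 1) :
    ConvergesMoreRapidly (fun t => bTransform f (fun t => ∫ x in a..t, f x) t k)
      (fun t => ∫ x in a..(k * t), f x) S := by
  set F : ℝ → ℝ := fun t => ∫ x in a..t, f x with hFdef
  have hk0 : 0 < k := by linarith
  have hFd : ∀ t, HasDerivAt F (f t) t := fun t =>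
    intervalIntegral.integral_hasDerivAt_right (hf.intervalIntegrable _ _)
      (hf.stronglyMeasurableAtFilter _ _) hf.continuousAt
  have h₁ : ∀ t, T ≤ t → HasDerivAt (fun t => S - F t) (-f t) t := fun t _ => by
    simpa using (hFd t).const_sub S
  have h₂ : ∀ t, T ≤ t → HasDerivAt (fun t => S - F (k * t)) (-(k * f (k * t))) t := fun t _ => by
    have hc := (hFd (k * t)).comp t ((hasDerivAt_id t).const_mul k)
    have := hc.const_sub S
    simpa [Function.comp_def, mul_comm] using this
  have hl₁ : Tendsto (fun t => S - F t) atTop (𝓝 0) := by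
    simpa using (tendsto_const_nhds (x := S)).sub hS
  have hscale : Tendsto (fun t => F (k * t)) atTop (𝓝 S) := hS.comp (tendsto_id.const_mul_atTop hk0)
  have hl₂ : Tendsto (fun t => S - F (k * t)) atTop (𝓝 0) := by
    simpa using (tendsto_const_nhds (x := S)).sub hscale
  have hg : ∀ t, T ≤ t → k * f (k * t) ≠ 0 := fun t ht =>
    mul_ne_zero hk0.ne' (hf0 (k * t) (by nlinarith))
  have core := tendsto_transform_div_tail (e₁ := fun t => S - F t) (e₂ := fun t => S - F (k * t))
    (g := fun t => k * f (k * t)) (R := fun t => tailScaleRatio f t k) T h₁ h₂ hg hl₁ hl₂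
    (fun t _ => rfl) hρ hρ0 hρ1
  have hev : ∀ᶠ t in atTop, tailScaleRatio f t k ≠ 1 := hρ.eventually (isOpen_ne.mem_nhds hρ1)
  refine core.congr' ?_
  filter_upwards [hev] with t ht
  rw [sub_bTransform_eq f F S t k ht]

/-! ### The analytic example of the text: `F(t) = ∫_0^t dx/(1 + x)²` -/

/-- `F(t) = ∫_0^t (1 + x)⁻² dx = 1 - 1/(t + 1)` for `t ≥ 0`. [folklore] (a general-interval version
`integral_inv_one_add_pow_two` already lives in `Literature/NumberTheory/Sieve/JurkatRichertRefutation`,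
not imported here to keep the anchor light). -/
private theorem integral_zero_inv_one_add_pow_two {t : ℝ} (ht : 0 ≤ t) :
    ∫ x in (0:ℝ)..t, 1 / (1 + x) ^ 2 = 1 - 1 / (t + 1) := by
  have hderiv : ∀ x ∈ uIcc (0:ℝ) t, HasDerivAt (fun x : ℝ => -(1 + x)⁻¹) (1 / (1 + x) ^ 2) x := by
    intro x hx
    rw [uIcc_of_le ht] at hx
    have hx1 : (1 + x) ≠ 0 := by linarith [hx.1]
    have h1 : HasDerivAt (fun x : ℝ => 1 + x) 1 x := by
      simpa using (hasDerivAt_id x).const_add 1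
    have h2 := (h1.fun_inv hx1).fun_neg
    exact h2.congr_deriv (by ring)
  have hcont : ContinuousOn (fun x : ℝ => 1 / (1 + x) ^ 2) (uIcc 0 t) := by
    rw [uIcc_of_le ht]
    refine ContinuousOn.div continuousOn_const (by fun_prop) fun x hx => ?_
    have : (0:ℝ) < 1 + x := by linarith [hx.1]
    positivity
  rw [integral_eq_sub_of_hasDerivAt hderiv (hcont.intervalIntegrable)]
  have h0 : (t + 1) ≠ 0 := by linarith
  field_simp
  ring

/-- `R(t, 1) = ((t + 1)/(t + 2))²` for `f(x) = (1 + x)⁻²`, `t ≥ 0`.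
[cite: DavisRabinowitz1984, Sect. 3.2.2 (Q-transform example)] -/
theorem tailRatio_inv_one_add_pow_two {t : ℝ} (ht : 0 ≤ t) :
    tailRatio (fun x => 1 / (1 + x) ^ 2) t 1 = ((t + 1) / (t + 2)) ^ 2 := by
  simp only [tailRatio]
  have h1 : (t + 1) ≠ 0 := by linarith
  have h2 : (t + 2) ≠ 0 := by linarith
  have h3 : (1 + (t + 1)) ≠ 0 := by linarith
  have h4 : (1 + t) ≠ 0 := by linarith
  field_simp
  ring

/-- `G[F; t, 1] = 1 - 1/(2t + 3)` in the example (`S = 1`; the G-transform error is `1/(2t + 3)` against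
`F`'s error `1/(t + 1)`).  [cite: DavisRabinowitz1984, Sect. 3.2.2 (Q-transform example)] -/
theorem gTransform_inv_one_add_pow_two {t : ℝ} (ht : 0 ≤ t) :
    gTransform (fun x => 1 / (1 + x) ^ 2) (fun s => ∫ x in (0:ℝ)..s, 1 / (1 + x) ^ 2) t 1 =
      1 - 1 / (2 * t + 3) := by
  rw [gTransform, tailRatio_inv_one_add_pow_two ht, integral_zero_inv_one_add_pow_two ht,
    integral_zero_inv_one_add_pow_two (by linarith)]
  have h1 : (t + 1) ≠ 0 := by linarith
  have h2 : (t + 2) ≠ 0 := by linarith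
  have h3 : (t + 1 + 1) ≠ 0 := by linarith
  have h4 : (2 * t + 3) ≠ 0 := by linarith
  have hlt : (t + 1) / (t + 2) < 1 := by rw [div_lt_one (by linarith)]; linarith
  have hge : 0 ≤ (t + 1) / (t + 2) := by positivity
  have hsq : ((t + 1) / (t + 2)) ^ 2 < 1 := by nlinarith
  have h5 : (1 : ℝ) - ((t + 1) / (t + 2)) ^ 2 ≠ 0 := by linarith
  rw [div_eq_iff h5]
  field_simp
  ring

/-- `q = lim_{t → ∞} t (1 - R(t, 1)) = 2` in the example.
[cite: DavisRabinowitz1984, Sect. 3.2.2 (Q-transform example)] -/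
theorem tendsto_q_inv_one_add_pow_two :
    Tendsto (fun t : ℝ => t * (1 - tailRatio (fun x => 1 / (1 + x) ^ 2) t 1)) atTop (𝓝 2) := by
  have key : ∀ᶠ t : ℝ in atTop,
      t * (1 - tailRatio (fun x => 1 / (1 + x) ^ 2) t 1) = (2 + 3 * t⁻¹) / (1 + 2 * t⁻¹) ^ 2 := by
    filter_upwards [eventually_gt_atTop (0:ℝ)] with t ht
    rw [tailRatio_inv_one_add_pow_two ht.le]
    have h2 : (t + 2) ≠ 0 := by linarith
    have h0 : t ≠ 0 := ht.ne'
    field_simp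
    ring
  have hinv : Tendsto (fun t : ℝ => t⁻¹) atTop (𝓝 0) := tendsto_inv_atTop_zero
  have hnum : Tendsto (fun t : ℝ => 2 + 3 * t⁻¹) atTop (𝓝 (2 + 3 * 0)) :=
    tendsto_const_nhds.add (hinv.const_mul 3)
  have hden : Tendsto (fun t : ℝ => (1 + 2 * t⁻¹) ^ 2) atTop (𝓝 ((1 + 2 * 0) ^ 2)) :=
    (tendsto_const_nhds.add (hinv.const_mul 2)).pow 2
  have := hnum.div hden (by norm_num)
  refine (this.congr' (key.mono fun t ht => ht.symm)).trans ?_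
  norm_num

/-- `Q[F; t] = 1 + 1/((t + 1)(2t + 3))` in the example (with `q = 2`).
[cite: DavisRabinowitz1984, Sect. 3.2.2 (Q-transform example)] -/
theorem qTransform_inv_one_add_pow_two {t : ℝ} (ht : 0 ≤ t) :
    qTransform (fun x => 1 / (1 + x) ^ 2) (fun s => ∫ x in (0:ℝ)..s, 1 / (1 + x) ^ 2) 2 t =
      1 + 1 / ((t + 1) * (2 * t + 3)) := by
  rw [qTransform, gTransform_inv_one_add_pow_two ht, integral_zero_inv_one_add_pow_two ht]
  have h1 : (t + 1) ≠ 0 := by linarith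
  have h4 : (2 * t + 3) ≠ 0 := by linarith
  field_simp
  ring

/-- In the example all three of `F(t)`, `G[F; t, 1]`, `Q[F; t]` converge to `S = 1`, with errors
`1/(t + 1)`, `1/(2t + 3)`, `-1/((t + 1)(2t + 3))`: `G` gains a factor ≈ 2, `Q` an order.
[cite: DavisRabinowitz1984, Sect. 3.2.2 (Q-transform example)] -/
theorem errors_inv_one_add_pow_two {t : ℝ} (ht : 0 ≤ t) :
    1 - (∫ x in (0:ℝ)..t, 1 / (1 + x) ^ 2) = 1 / (t + 1) ∧
    1 - gTransform (fun x => 1 / (1 + x) ^ 2) (fun s => ∫ x in (0:ℝ)..s, 1 / (1 + x) ^ 2) t 1 =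
        1 / (2 * t + 3) ∧
    1 - qTransform (fun x => 1 / (1 + x) ^ 2) (fun s => ∫ x in (0:ℝ)..s, 1 / (1 + x) ^ 2) 2 t =
        -(1 / ((t + 1) * (2 * t + 3))) := by
  rw [integral_zero_inv_one_add_pow_two ht, gTransform_inv_one_add_pow_two ht, qTransform_inv_one_add_pow_two ht]
  refine ⟨by ring, by ring, by ring⟩

/-! ### The `sin x / x` example: the shape of `G[F; t, π]` -/

/-- For `f(x) = sin x / x`: `R(t; π) = -t/(t + π)` (`t ≠ 0`, `t ≠ -π`, `sin t ≠ 0`).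
[cite: DavisRabinowitz1984, Sect. 3.2.2 (G-transform example)] -/
theorem tailRatio_sinc_pi {t : ℝ} (ht : t ≠ 0) (htπ : t + Real.pi ≠ 0) (hs : Real.sin t ≠ 0) :
    tailRatio (fun x => Real.sin x / x) t Real.pi = -t / (t + Real.pi) := by
  simp only [tailRatio, Real.sin_add_pi]
  field_simp

/-- With `R(t; π) = -t/(t + π)` the G-transform is the weighted mean
`G[F; t, π] = (t + π)/(2t + π) F(t + π) + t/(2t + π) F(t)` (`t + π ≠ 0`; at `2t + π = 0` both
sides are `0` by the division convention).
[cite: DavisRabinowitz1984, Sect. 3.2.2 (G-transform example)] -/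
theorem gTransform_of_tailRatio_eq {f F : ℝ → ℝ} {t : ℝ}
    (hR : tailRatio f t Real.pi = -t / (t + Real.pi)) (h1 : t + Real.pi ≠ 0) :
    gTransform f F t Real.pi =
      (t + Real.pi) / (2 * t + Real.pi) * F (t + Real.pi) + t / (2 * t + Real.pi) * F t := by
  rw [gTransform, hR]
  field_simp
  ring

end Literature.Analysis.Quadrature

end
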